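import Literature.Barriers.ValiantsHypothesis.BIJL18PermanentZeroFactorClosureProofs
import Literature.Computability.AlgebraicComplexity.KaltofenFactorClosureProofs
import Literature.Computability.AlgebraicComplexity.ValiantConjectureEquivProofs
import HarnessLib

/-!
# Bläser–Ikenmeyer–Jindal–Lysikov 2018, §6 — the `VP⁰`-natural-proofs barrier for `{Per = 0}`
# in Valiant-hypothesis form, now UNCONDITIONAL on Kaltofen (factor closure over `ℂ` is proved)

Theorem-only sequel of `BIJL18PermanentZeroFactorClosureProofs.lean` (val-lit cell). There, the
algebraic shadow of [BlaserIkenmeyerJindalLysikov2018] Thm. 6 ("if there are `VP⁰`-natural proofs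
over characteristic zero against the set of matrices with permanent zero, then `P^{#P} ⊆ ∃BPP`")
was derived CONDITIONALLY on the tree's named fact `KaltofenFactorBound ℚ` (Kaltofen 1989 /
Bürgisser 2024 Thm. 3.2: factors of polynomials with small circuits have small circuits):
`KaltofenFactorBound ℚ → PerNotPComputableComplex → ¬ HasVP0NaturalProofsAgainstPerZero`.

Kaltofen's theorem is now PROVED in the tree over every algebraically closed field of
characteristic zero (`kaltofenFactorBound_complex : KaltofenFactorBound ℂ`,
`KaltofenFactorClosureProofs.lean`). Since a `VP⁰`-natural proof `D_n ∈ ℤ[x]` against `{Per = 0}`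
is a nonzero multiple of `Per_n` over `ℚ` (`hasVP0NaturalProofsAgainstPerZero_iff_perPoly_dvd`),
hence over `ℂ` after extension of scalars, the factor bound over `ℂ` suffices, and the Kaltofen
hypothesis disappears:

* `isPComputable_perPoly_complex_of_hasVP0NaturalProofsAgainstPerZero'` — `VP⁰`-natural proofs
  against `{Per = 0}` make the permanent family p-computable over `ℂ` (UNCONDITIONAL);
* `isVPFamily_perPoly_complex_of_hasVP0NaturalProofsAgainstPerZero` — hence `Per ∈ VP_ℂ`;
* `not_hasVP0NaturalProofsAgainstPerZero_of_perNotPComputableComplex'` — **Valiant's hypothesis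
  over `ℂ` (`PerNotPComputableComplex`, equivalently `VP_ℂ ≠ VNP_ℂ`) rules out `VP⁰`-natural
  proofs against the set of matrices with permanent zero**, with NO further hypothesis;
* `not_hasVP0NaturalProofsAgainstPerZero_of_VP_ne_VNP` — the same with the hypothesis spelled
  `VP ℂ ≠ VNP ℂ` (`perNotPComputableComplex_iff_holds`, von zur Gathen 1987 Prop. 4.8).

HONEST FRAMING. This is the DERIVED Valiant-hypothesis form of BIJL's barrier, not the printed
Thm. 6 (whose hypothesis is Boolean, `P^{#P} ⊄ ∃BPP`, and whose proof factors over `𝔽_p` to stay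
constant-free); `BIJL2018_thm5`/`BIJL2018_thm6` are NOT discharged; no named fact is introduced;
`VP ≠ VNP` (here a HYPOTHESIS) is NOT proved and nothing here is progress on it. What it says for
the programme: conditionally on Valiant's hypothesis itself, equations for `{per = 0}` of
`VP⁰`-size do not exist — an algebraic natural-proofs barrier of the BIJL type holds exactly when
the separation it would be used to prove is true.

## References

* [BlaserIkenmeyerJindalLysikov2018] M. Bläser, C. Ikenmeyer, G. Jindal, V. Lysikov, *Generalized
  matrix completion and algebraic natural proofs*, STOC 2018 / ECCC TR18-064, §6 (Thms. 5, 6; p.17).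
* [Burgisser2024Completeness] P. Bürgisser, *Completeness classes in algebraic complexity theory*,
  arXiv:2406.06217, Thm. 3.2, Cor. 3.3.
* [Kaltofen1989] E. Kaltofen, *Factorization of polynomials given by straight-line programs* (1989).
* [Vonzurgathen1987Feasible] J. von zur Gathen, *Feasible arithmetic computations: Valiant's
  hypothesis*, J. Symb. Comput. 4 (1987), Prop. 4.8.
-/

noncomputable section

namespace Literature.Barriers.ValiantsHypothesis

open MvPolynomial Literature.Computability.AlgebraicComplexity

/-- Base change does not increase the total degree (plumbing). [folklore] -/
private theorem totalDegree_map_le_aux' {R S σ : Type*} [CommSemiring R] [CommSemiring S]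
    (f : R →+* S) (p : MvPolynomial σ R) : (map f p).totalDegree ≤ p.totalDegree :=
  Finset.sup_mono (support_map_subset f p)

/-- **`VP⁰`-natural proofs against `{Per = 0}` put the permanent in `VP_ℂ` — unconditionally.**
If there are `VP⁰`-natural proofs against the set of matrices with permanent zero
(`HasVP0NaturalProofsAgainstPerZero`, the typed hypothesis of `BIJL2018_thm6`), then the permanent
family is p-computable over `ℂ`: the natural proofs `D_n ≠ 0` are multiples of `Per_n`
(`hasVP0NaturalProofsAgainstPerZero_iff_perPoly_dvd`), also after `ℤ → ℂ`, of p-bounded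
constant-free size and degree, and Kaltofen's theorem over `ℂ` (`kaltofenFactorBoundWith_of_isAlgClosed`,
PROVED) gives `L_ℂ(Per_n) ≤ (L(D_n) + deg D_n + 2)^12`. The twin of
`isPComputable_perPoly_complex_of_hasVP0NaturalProofsAgainstPerZero` without its Kaltofen hypothesis.
[cite: BlaserIkenmeyerJindalLysikov2018, §6 (Thm. 6; proof of Thm. 5, steps 4–6)] locator: ECCC pp.17–19;
[cite: Burgisser2024Completeness, Thm. 3.2] -/
theorem isPComputable_perPoly_complex_of_hasVP0NaturalProofsAgainstPerZero'
    (h : HasVP0NaturalProofsAgainstPerZero) :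
    IsPComputable (fun n => perPoly (Fin n) ℂ) := by
  obtain ⟨D, hVP, hD⟩ := hasVP0NaturalProofsAgainstPerZero_iff_perPoly_dvd.1 h
  have hs : IsPBounded fun n => constantFreeComplexity (D n) :=
    hVP.isPBounded_constantFreeComplexity
  have hd : IsPBounded fun n => (D n).totalDegree := hVP.isPFamily.2
  refine (IsPBounded.pow_holds (IsPBounded.add_holds (IsPBounded.add_holds hs hd)
    (IsPBounded.const 2)) 12).mono fun n => ?_
  -- the natural proof over `ℂ`, in `Fin (n·n)` variables (where Kaltofen's bound is stated)
  set D' : MvPolynomial (Fin n × Fin n) ℂ := map (Int.castRingHom ℂ) (D n) with hD'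
  have hD'0 : D' ≠ 0 := by
    intro h0
    apply (hD n).1
    apply map_injective (Int.castRingHom ℂ) Int.cast_injective
    rw [map_zero]
    exact h0
  -- `Per_n ∣ D_n` over `ℚ`, hence over `ℂ`
  have hdvdC : perPoly (Fin n) ℂ ∣ D' := by
    have h1 := map_dvd (map (algebraMap ℚ ℂ) :
      MvPolynomial (Fin n × Fin n) ℚ →+* MvPolynomial (Fin n × Fin n) ℂ) (hD n).2
    rw [map_perPoly, map_map] at h1
    have hcomp : (algebraMap ℚ ℂ).comp (Int.castRingHom ℚ) = Int.castRingHom ℂ :=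
      RingHom.ext_int _ _
    rwa [hcomp] at h1
  set e : Fin n × Fin n ≃ Fin (n * n) := finProdFinEquiv with he
  have hne : rename e D' ≠ 0 := (map_ne_zero_iff _ (rename_injective _ e.injective)).2 hD'0
  have hdvd : rename e (perPoly (Fin n) ℂ) ∣ rename e D' := map_dvd _ hdvdC
  have hk := kaltofenFactorBoundWith_of_isAlgClosed ℂ (n * n) (rename e D')
    (rename e (perPoly (Fin n) ℂ)) hne hdvd
  have hper : complexity (rename e (perPoly (Fin n) ℂ)) = complexity (perPoly (Fin n) ℂ) :=
    complexity_renameEquiv_holds e (perPoly (Fin n) ℂ)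
  have hDe : complexity (rename e D') = complexity D' := complexity_renameEquiv_holds e D'
  rw [hper] at hk
  refine hk.trans (Nat.pow_le_pow_left ?_ 12)
  have h1 : complexity (rename e D') ≤ constantFreeComplexity (D n) :=
    hDe.le.trans (ArithCircuit.complexity_map_le_constantFreeComplexity _ _)
  have h2 : (rename e D').totalDegree ≤ (D n).totalDegree :=
    (totalDegree_rename_le _ _).trans (totalDegree_map_le_aux' _ _)
  omega

/-- **Corollary: `VP⁰`-natural proofs against `{Per = 0}` put the permanent family in `VP_ℂ`**
(`IsVPFamily`; the p-family half is `isPFamily_perPoly_holds`) — unconditionally.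
[cite: BlaserIkenmeyerJindalLysikov2018, §6 (Thm. 6)] locator: ECCC pp.17–19;
[cite: Burgisser2024Completeness, Cor. 3.3] -/
theorem isVPFamily_perPoly_complex_of_hasVP0NaturalProofsAgainstPerZero
    (h : HasVP0NaturalProofsAgainstPerZero) :
    IsVPFamily (fun n => perPoly (Fin n) ℂ) := by
  refine ⟨?_, isPComputable_perPoly_complex_of_hasVP0NaturalProofsAgainstPerZero' h⟩
  have hpf := @isPFamily_perPoly_holds ℂ
  unfold isPFamily_perPoly at hpf
  exact hpf

/-- **The BIJL barrier in Valiant-hypothesis form — UNCONDITIONAL.** Valiant's hypothesis over `ℂ`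
(`PerNotPComputableComplex`: the permanent family is not p-computable over `ℂ`; an open conjecture,
here a HYPOTHESIS) rules out `VP⁰`-natural proofs against the set of matrices with permanent zero.
The twin of `not_hasVP0NaturalProofsAgainstPerZero_of_perNotPComputableComplex` with its Kaltofen
hypothesis DISCHARGED (`kaltofenFactorBound_complex`). BIJL's printed Thm. 6 is the variant with the
Boolean hypothesis `P^{#P} ⊄ ∃BPP`. Derived consequence recorded next to the LOAD-BEARING fact
`BIJL2018_thm6`; not a printed statement of [BIJL18].
[cite: BlaserIkenmeyerJindalLysikov2018, §6 (Thm. 6 and p.17)] locator: ECCC pp.17–19;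
[cite: Burgisser2024Completeness, Cor. 3.3] -/
theorem not_hasVP0NaturalProofsAgainstPerZero_of_perNotPComputableComplex'
    (hV : PerNotPComputableComplex) : ¬ HasVP0NaturalProofsAgainstPerZero :=
  fun h => hV (isPComputable_perPoly_complex_of_hasVP0NaturalProofsAgainstPerZero' h)

/-- **The same barrier with the hypothesis spelled `VP_ℂ ≠ VNP_ℂ`** (the tree's classes `VP`,
`VNP` of `ValiantConjecture.lean`; `perNotPComputableComplex_iff_holds`, von zur Gathen 1987
Prop. 4.8 / Bürgisser 2000 Rem. 2.11): if `VP_ℂ ≠ VNP_ℂ` then there are no `VP⁰`-natural proofs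
against the set of matrices with permanent zero.
[cite: BlaserIkenmeyerJindalLysikov2018, §6 (Thm. 6)] locator: ECCC pp.17–19;
[cite: Vonzurgathen1987Feasible, Prop. 4.8] -/
theorem not_hasVP0NaturalProofsAgainstPerZero_of_VP_ne_VNP (hV : VP ℂ ≠ VNP ℂ) :
    ¬ HasVP0NaturalProofsAgainstPerZero :=
  not_hasVP0NaturalProofsAgainstPerZero_of_perNotPComputableComplex'
    (perNotPComputableComplex_iff_holds.2 hV)

/-! ### Over `ℚ` itself (Kaltofen's theorem is now proved over every field of characteristic
zero: `kaltofenFactorBound_rat`) -/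

/-- **Unconditional over `ℚ`:** `VP⁰`-natural proofs against `{Per = 0}` make the permanent
family p-computable over `ℚ` — the hypothesis `KaltofenFactorBound ℚ` of
`isPComputable_perPoly_rat_of_hasVP0NaturalProofsAgainstPerZero` is discharged by
`kaltofenFactorBound_rat` (`KaltofenFactorClosureProofs.lean`, étale descent). Derived algebraic
consequence recorded next to the load-bearing fact `BIJL2018_thm6`; not the printed (Boolean,
constant-free) statement. [cite: BlaserIkenmeyerJindalLysikov2018, §6 (Thm. 6; proof of Thm. 5, steps 4–6)] locator: ECCC pp.17–19;
[cite: Burgisser2024Completeness, Thm. 3.2] -/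
theorem isPComputable_perPoly_rat_of_hasVP0NaturalProofsAgainstPerZero'
    (h : HasVP0NaturalProofsAgainstPerZero) : IsPComputable (fun n => perPoly (Fin n) ℚ) :=
  isPComputable_perPoly_rat_of_hasVP0NaturalProofsAgainstPerZero kaltofenFactorBound_rat h

/-- **Unconditional over `ℚ`:** `VP⁰`-natural proofs against `{Per = 0}` put the permanent family
in `VP` over `ℚ`. [cite: BlaserIkenmeyerJindalLysikov2018, §6 (Thm. 6)] locator: ECCC pp.17–19;
[cite: Burgisser2024Completeness, Cor. 3.3] -/
theorem isVPFamily_perPoly_rat_of_hasVP0NaturalProofsAgainstPerZero'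
    (h : HasVP0NaturalProofsAgainstPerZero) : IsVPFamily (fun n => perPoly (Fin n) ℚ) :=
  isVPFamily_perPoly_rat_of_hasVP0NaturalProofsAgainstPerZero kaltofenFactorBound_rat h

end Literature.Barriers.ValiantsHypothesis

end
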